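import Summits.KontsevichZagierPeriods.KontsevichZagierPeriods.Theorems.RealPeriodSectorComplete.Negative.LoadBearing

/-!
# `RealPeriodSectorComplete` (stmt-KontsevichZagierPeriods-5381) — negative knowledge, part 2: refuted strengthenings, and "ℚ-isomorphic models are one move"

Second model `y² = x³ − 64` (the `u = 2` rescaling `(A,B) ↦ (u⁴A, u⁶B)` of the Fermat cubic),
its representation `fermat64Rep b = [{x³−64>0}, b/√(x³−64)]`, and:

* CALIBRATION: `[{x³−1>0}, a/√(x³−1)] − [{X³−64>0}, 2a/√(X³−64)]` is ONE change-of-variables move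
  (`of_fermatRep_sub_of_fermat64Rep_mem`, `Φ(x) = 4x`, `|det Φ′| = 4`); the value of the second
  model is read off from soundness (`value_fermat64Rep`); across the two models the classes are the
  lines `b = 2a` (`equivalent_fermatRep_fermat64Rep_iff`).
* REFUTED STRENGTHENINGS of the crux: `RealPeriodSectorCompleteDataRigid` ("equivalent ⇒ same
  `(A, B, a)`") — false; `RealPeriodSectorCompleteByAdditivity` (conclusion in the subgroup
  generated by the additivity moves (1a), (1b) alone) — false: the tree's invariant
  `KZ.restrictedEval` at the window `x ≤ 4` separates the scaling pair. A change of variables or a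
  Newton–Leibniz move is NECESSARY in this sector, already for ℚ-isomorphic models.
[cite: KontsevichZagier2001, §1.2 Conjecture 1]
-/

noncomputable section

open MeasureTheory Set Filter MvPolynomial
open Literature.ModelTheory.ExponentialFields (IsSemialgebraic isSemialgebraic_setOf_eval_pos
  isSemialgebraic_setOf_eval_eq_zero)
open Literature.NumberTheory.Transcendental
open Literature.NumberTheory.Transcendental.KZ

namespace Summit.KontsevichZagierPeriods.IsogenyCertificates.RealPeriodSectorCompleteNegative

open Summit.KontsevichZagierPeriods.KontsevichZagierPeriods.Theses.IsogenyCertificates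
  (RealPeriodSectorComplete)

/-! ## §4 Refuted natural strengthenings — and the calibration "ℚ-isomorphic models are ONE move"

Second model: `y² = x³ − 64`, the `u = 2` rescaling `(A, B) ↦ (u⁴A, u⁶B)` of the Fermat cubic;
`{x³ − 64 > 0} = (4, ∞)` and `∫_{4}^∞ dX/√(X³ − 64) = ϖ₃/2` (`X = 4x`). -/

/-- `{x³ − 64 > 0} = {x > 4}`. [folklore] -/
theorem dom_fermat64_eq : dom 0 (-64) = (MeasurableEquiv.funUnique (Fin 1) ℝ) ⁻¹' Ioi 4 := by
  ext x
  simp only [dom, Int.cast_zero, zero_mul, add_zero, Int.cast_neg, Int.cast_ofNat, mem_setOf_eq,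
    mem_preimage, mem_Ioi, funUnique_apply_eq]
  have hq : 0 < x 0 ^ 2 + 4 * x 0 + 16 := by nlinarith [sq_nonneg (x 0 + 2)]
  have hf : x 0 ^ 3 + -64 = (x 0 - 4) * (x 0 ^ 2 + 4 * x 0 + 16) := by ring
  rw [hf]
  constructor
  · intro h
    by_contra hle
    push Not at hle
    have : (x 0 - 4) * (x 0 ^ 2 + 4 * x 0 + 16) ≤ 0 :=
      mul_nonpos_of_nonpos_of_nonneg (by linarith) hq.le
    linarith
  · intro h
    exact mul_pos (by linarith) hq

/-- The second integrand factors through `ℝ¹ ≃ ℝ`. [folklore] -/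
theorem integrand_fermat64_eq (b : ℚ) :
    integrand 0 (-64) b = (fun t : ℝ => (b : ℝ) * (Real.sqrt (t ^ 3 - 64))⁻¹) ∘
      (MeasurableEquiv.funUnique (Fin 1) ℝ) := by
  funext x
  simp only [integrand, Int.cast_zero, zero_mul, add_zero, Int.cast_neg, Int.cast_ofNat,
    Function.comp_apply, funUnique_apply_eq]
  rw [div_eq_mul_inv, ← sub_eq_add_neg]

/-- `√(64y) = 8√y`. [folklore] -/
theorem sqrt_sixtyfour_mul {y : ℝ} : Real.sqrt (64 * y) = 8 * Real.sqrt y := by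
  rw [Real.sqrt_mul (by norm_num : (0 : ℝ) ≤ 64), show (64 : ℝ) = 8 ^ 2 by norm_num,
    Real.sqrt_sq (by norm_num : (0 : ℝ) ≤ 8)]

/-- `(t³ − 64)^{-1/2}` is integrable on `(4, ∞)`: it is `x ↦ (8√(x³ − 1))⁻¹` after `t = 4x`. [folklore] -/
theorem integrableOn_inv_sqrt_cube_sub_64_Ioi :
    IntegrableOn (fun t : ℝ => (Real.sqrt (t ^ 3 - 64))⁻¹) (Ioi 4) := by
  have h1 : IntegrableOn (fun x : ℝ => (8 : ℝ)⁻¹ * (Real.sqrt (x ^ 3 - 1))⁻¹) (Ioi 1) :=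
    integrableOn_inv_sqrt_cube_sub_one_Ioi.const_mul _
  have h2 : IntegrableOn (fun x : ℝ => (Real.sqrt ((4 * x) ^ 3 - 64))⁻¹) (Ioi 1) := by
    refine h1.congr_fun (fun x _ => ?_) measurableSet_Ioi
    have h64 : (4 * x) ^ 3 - 64 = 64 * (x ^ 3 - 1) := by ring
    rw [h64, sqrt_sixtyfour_mul, mul_inv]
  have h3 := (integrableOn_Ioi_comp_mul_left_iff (f := fun t : ℝ => (Real.sqrt (t ^ 3 - 64))⁻¹)
    (c := 1) (a := 4) (by norm_num)).1 h2
  simpa using h3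

/-- `b/√(x³ − 64)` is integrable on `{x³ − 64 > 0}`. [folklore] -/
theorem integrableOn_integrand_fermat64 (b : ℚ) :
    IntegrableOn (integrand 0 (-64) b) (dom 0 (-64)) := by
  rw [dom_fermat64_eq, integrand_fermat64_eq]
  exact ((volume_preserving_funUnique (Fin 1) ℝ).integrableOn_comp_preimage
    (MeasurableEquiv.measurableEmbedding _)).2
    (integrableOn_inv_sqrt_cube_sub_64_Ioi.const_mul (b : ℝ))

/-- The real-sector representation `[{x³ − 64 > 0}, b/√(x³ − 64)]` of `y² = x³ − 64`. -/
def fermat64Rep (b : ℚ) : IntegralRep 1 where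
  domain := dom 0 (-64)
  integrand := integrand 0 (-64) b
  isSemialgebraic_domain := isSemialgebraic_dom 0 (-64)
  isSemialgebraicFunOn_integrand := isSemialgebraicFunOn_integrand 0 (-64) b
  integrableOn := integrableOn_integrand_fermat64 b

/-- The hypotheses of the crux at `(A′, B′, b) = (0, −64, b)` hold for `fermat64Rep b` (by `rfl`). -/
theorem fermat64Rep_hyps (b : ℚ) :
    (fermat64Rep b).domain = {x | 0 < x 0 ^ 3 + ((0 : ℤ) : ℝ) * x 0 + ((-64 : ℤ) : ℝ)} ∧
    EqOn (fermat64Rep b).integrand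
      (fun x => (b : ℝ) / Real.sqrt (x 0 ^ 3 + ((0 : ℤ) : ℝ) * x 0 + ((-64 : ℤ) : ℝ)))
      (fermat64Rep b).domain :=
  ⟨rfl, fun _ _ => rfl⟩

/-- The scaling `x ↦ 4x` of `ℝ¹` and its derivative. -/
def Φ₄ : (Fin 1 → ℝ) → (Fin 1 → ℝ) := fun x => (4 : ℝ) • x

/-- The (constant) derivative of `Φ₄`. -/
def Φ₄' : (Fin 1 → ℝ) →L[ℝ] (Fin 1 → ℝ) := (4 : ℝ) • ContinuousLinearMap.id ℝ (Fin 1 → ℝ)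

/-- `det Φ₄′ = 4`. [folklore] -/
theorem det_Φ₄' : Φ₄'.det = 4 := by
  simp [Φ₄', ContinuousLinearMap.det, LinearMap.det_smul]

/-- `Φ₄` maps `{x > 1}` onto `{x > 4}`. [folklore] -/
theorem image_Φ₄_dom : Φ₄ '' dom 0 (-1) = dom 0 (-64) := by
  rw [dom_fermat_eq, dom_fermat64_eq]
  ext x
  simp only [mem_image, mem_preimage, mem_Ioi, Φ₄, funUnique_apply_eq]
  constructor
  · rintro ⟨y, hy, rfl⟩
    simp only [Pi.smul_apply, smul_eq_mul]
    linarith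
  · intro hx
    refine ⟨(1 / 4 : ℝ) • x, ?_, ?_⟩
    · simp only [Pi.smul_apply, smul_eq_mul]
      linarith
    · rw [smul_smul]
      norm_num

/-- **ℚ-isomorphic models are ONE change of variables**: `[{x³−1>0}, a/√(x³−1)] − [{X³−64>0},
2a/√(X³−64)]` is an instance of rule 2) with `Φ(x) = 4x` (`dX/√(X³ − 64) = dx/(2√(x³ − 1))`). This is
the `u`-scaling case `(A′, B′) = (u⁴A, u⁶B)`, `b = u·a` of the crux, certified on the witness. [folklore] -/
theorem of_fermatRep_sub_of_fermat64Rep_mem (a : ℚ) :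
    KZ.of (fermatRep a) - KZ.of (fermat64Rep (2 * a)) ∈ changeOfVariablesRel := by
  refine ⟨1, fermatRep a, fermat64Rep (2 * a), Φ₄, fun _ => Φ₄', ?_, ?_, ?_, ?_, ?_, rfl⟩
  · refine (isSemialgebraicMapOn_aeval (isSemialgebraic_dom 0 (-1))
      (fun _ => C (4 : ℚ) * X 0)).congr (fun x _ => ?_)
    funext j
    have hj : j = 0 := Subsingleton.elim j 0
    subst hj
    simp [Φ₄]
  · intro x _
    exact (hasFDerivWithinAt_id x _).const_smul (4 : ℝ)
  · exact (smul_right_injective (Fin 1 → ℝ) (by norm_num : (4 : ℝ) ≠ 0)).injOn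
  · exact image_Φ₄_dom.symm
  · intro x hx
    have hx1 : 1 < x 0 := by
      have : x ∈ (MeasurableEquiv.funUnique (Fin 1) ℝ) ⁻¹' Ioi 1 := dom_fermat_eq ▸ hx
      simpa [funUnique_apply_eq] using this
    have hP : 0 < x 0 ^ 3 + -1 := by have := cube_sub_one_pos hx1; linarith
    have hs : 0 < Real.sqrt (x 0 ^ 3 + -1) := Real.sqrt_pos.2 hP
    show integrand 0 (-1) a x = integrand 0 (-64) (2 * a) (Φ₄ x) * |Φ₄'.det|
    rw [det_Φ₄']
    simp only [integrand, Φ₄, Pi.smul_apply, smul_eq_mul, Int.cast_zero, zero_mul, add_zero,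
      Int.cast_neg, Int.cast_one, Int.cast_ofNat]
    have h64 : (4 * x 0) ^ 3 + -64 = 64 * (x 0 ^ 3 + -1) := by ring
    rw [h64, sqrt_sixtyfour_mul, abs_of_pos (by norm_num : (0 : ℝ) < 4)]
    push_cast
    field_simp
    ring

/-- The two witnesses are KZ-equivalent (one move). [folklore] -/
theorem equivalent_fermatRep_fermat64Rep (a : ℚ) : Equivalent (fermatRep a) (fermat64Rep (2 * a)) :=
  changeOfVariablesRel_subset_relations (of_fermatRep_sub_of_fermat64Rep_mem a)

/-- `value [{X³−64>0}, 2a/√(X³−64)] = a·ϖ₃` — read off from SOUNDNESS of the move, no second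
integral computed. [folklore] -/
theorem value_fermat64Rep_two_mul (a : ℚ) : (fermat64Rep (2 * a)).value = (a : ℝ) * fermatPeriod := by
  rw [← Equivalent.value_eq_holds (equivalent_fermatRep_fermat64Rep a), value_fermatRep]

/-- `value [{X³−64>0}, b/√(X³−64)] = (b/2)·ϖ₃`. [folklore] -/
theorem value_fermat64Rep (b : ℚ) : (fermat64Rep b).value = (b : ℝ) / 2 * fermatPeriod := by
  have h := value_fermat64Rep_two_mul (b / 2)
  rw [mul_div_cancel₀ b two_ne_zero] at h
  rw [h]
  push_cast
  ring

/-- Across the two models the classes are exactly the lines `b = 2a`: the calculus sees the period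
ratio and nothing else. [folklore] -/
theorem equivalent_fermatRep_fermat64Rep_iff (a b : ℚ) :
    Equivalent (fermatRep a) (fermat64Rep b) ↔ b = 2 * a := by
  constructor
  · intro h
    have hv := Equivalent.value_eq_holds h
    rw [value_fermatRep, value_fermat64Rep] at hv
    have := mul_right_cancel₀ fermatPeriod_pos.ne' hv
    have h' : (a : ℝ) * 2 = b := by linarith
    exact_mod_cast (by linarith : (b : ℝ) = 2 * a)
  · rintro rfl
    exact equivalent_fermatRep_fermat64Rep a

/-! ### (4a) "data rigidity" is false: equivalent representations need not come from the same model -/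

/-- STRENGTHENING: under the hypotheses of the crux, equivalence forces equal data. -/
def RealPeriodSectorCompleteDataRigid : Prop :=
  ∀ (A B A' B' : ℤ), 4 * A ^ 3 + 27 * B ^ 2 ≠ 0 → 4 * A' ^ 3 + 27 * B' ^ 2 ≠ 0 → ∀ (a b : ℚ),
    0 < a → 0 < b → ∀ (r r' : IntegralRep 1),
    r.domain = {x | 0 < x 0 ^ 3 + (A : ℝ) * x 0 + (B : ℝ)} →
    EqOn r.integrand (fun x => (a : ℝ) / Real.sqrt (x 0 ^ 3 + (A : ℝ) * x 0 + (B : ℝ))) r.domain →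
    r'.domain = {x | 0 < x 0 ^ 3 + (A' : ℝ) * x 0 + (B' : ℝ)} →
    EqOn r'.integrand (fun x => (b : ℝ) / Real.sqrt (x 0 ^ 3 + (A' : ℝ) * x 0 + (B' : ℝ)))
      r'.domain →
    Equivalent r r' → A = A' ∧ B = B' ∧ a = b

/-- Refuted by the scaling witness `(0, −1, 1) ~ (0, −64, 2)`. [folklore] -/
theorem not_RealPeriodSectorCompleteDataRigid : ¬ RealPeriodSectorCompleteDataRigid := by
  intro h
  have := (h 0 (-1) 0 (-64) (by norm_num) (by norm_num) 1 2 one_pos two_pos (fermatRep 1)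
    (fermat64Rep 2) (fermatRep_hyps 1).1 (fermatRep_hyps 1).2 (fermat64Rep_hyps 2).1
    (fermat64Rep_hyps 2).2 (by simpa using equivalent_fermatRep_fermat64Rep 1)).2.1
  norm_num at this

/-! ### (4b) The additivity moves (1a) + (1b) alone do NOT suffice: a change of variables (or a
Newton–Leibniz move) is NECESSARY already for ℚ-isomorphic models -/

/-- STRENGTHENING: the crux with the conclusion sharpened to "equivalent by the additivity moves
alone". -/
def RealPeriodSectorCompleteByAdditivity : Prop :=
  ∀ (A B A' B' : ℤ), 4 * A ^ 3 + 27 * B ^ 2 ≠ 0 → 4 * A' ^ 3 + 27 * B' ^ 2 ≠ 0 → ∀ (a b : ℚ),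
    0 < a → 0 < b → ∀ (r r' : IntegralRep 1),
    r.domain = {x | 0 < x 0 ^ 3 + (A : ℝ) * x 0 + (B : ℝ)} →
    EqOn r.integrand (fun x => (a : ℝ) / Real.sqrt (x 0 ^ 3 + (A : ℝ) * x 0 + (B : ℝ))) r.domain →
    r'.domain = {x | 0 < x 0 ^ 3 + (A' : ℝ) * x 0 + (B' : ℝ)} →
    EqOn r'.integrand (fun x => (b : ℝ) / Real.sqrt (x 0 ^ 3 + (A' : ℝ) * x 0 + (B' : ℝ)))
      r'.domain →
    r.value = r'.value →
    KZ.of r - KZ.of r' ∈ AddSubgroup.closure (domainAddRel ∪ integrandAddRel)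

/-- The window family `(−∞, 4]ⁿ` for the tree's invariant `KZ.restrictedEval`. -/
def W4 : (n : ℕ) → Set (Fin n → ℝ) := fun n => Set.pi univ fun _ : Fin n => Iic (4 : ℝ)

/-- The windows are measurable. [folklore] -/
theorem measurableSet_W4 (n : ℕ) : MeasurableSet (W4 n) :=
  MeasurableSet.univ_pi fun _ => measurableSet_Iic

/-- The scaling pair is separated from the additivity sub-calculus by `restrictedEval` at the
window `x ≤ 4`: `[{x>1}, 1/√(x³−1)]` restricts to `∫₁⁴ > 0`, `[{X>4}, 2/√(X³−64)]` to `0`. [folklore] -/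
theorem of_fermatRep_sub_of_fermat64Rep_not_mem_closure_add :
    KZ.of (fermatRep 1) - KZ.of (fermat64Rep 2) ∉ AddSubgroup.closure (domainAddRel ∪ integrandAddRel) := by
  intro hmem
  have hker := closure_add_le_ker_restrictedEval W4 measurableSet_W4 hmem
  rw [AddMonoidHom.mem_ker, map_sub, restrictedEval_of, restrictedEval_of] at hker
  have h0 : ∫ x in (fermat64Rep 2).domain ∩ W4 1, (fermat64Rep 2).integrand x = 0 := by
    have hempty : (fermat64Rep 2).domain ∩ W4 1 = ∅ := by
      ext x
      simp only [mem_inter_iff, mem_empty_iff_false, iff_false, not_and]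
      intro hx hW
      have hx4 : 4 < x 0 := by
        have : x ∈ (MeasurableEquiv.funUnique (Fin 1) ℝ) ⁻¹' Ioi 4 := dom_fermat64_eq ▸ hx
        simpa [funUnique_apply_eq] using this
      have hle : x 0 ≤ 4 := by
        have := hW 0 (mem_univ _)
        simpa using this
      linarith
    rw [hempty, Measure.restrict_empty, integral_zero_measure]
  have hpos : 0 < ∫ x in (fermatRep 1).domain ∩ W4 1, (fermatRep 1).integrand x := by
    have hmeas : MeasurableSet ((fermatRep 1).domain ∩ W4 1) :=
      (IntegralRep.measurableSet_domain_holds _).inter (measurableSet_W4 1)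
    rw [setIntegral_pos_iff_support_of_nonneg_ae ?_
      ((fermatRep 1).integrableOn.mono_set inter_subset_left)]
    · have hopen : IsOpen {x : Fin 1 → ℝ | 1 < x 0 ∧ x 0 < 4} :=
        (isOpen_lt continuous_const (continuous_apply 0)).inter
          (isOpen_lt (continuous_apply 0) continuous_const)
      have hne : ({x : Fin 1 → ℝ | 1 < x 0 ∧ x 0 < 4}).Nonempty := ⟨fun _ => 2, by norm_num⟩
      refine (hopen.measure_pos volume hne).trans_le (measure_mono fun x hx => ?_)
      have hx1 : 1 < x 0 := hx.1
      have hxd : x ∈ (fermatRep 1).domain := by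
        show x ∈ dom 0 (-1)
        rw [dom_fermat_eq]
        simpa [funUnique_apply_eq] using hx1
      refine ⟨?_, hxd, fun i _ => ?_⟩
      · rw [Function.mem_support]
        show integrand 0 (-1) 1 x ≠ 0
        simp only [integrand, Int.cast_zero, zero_mul, add_zero, Int.cast_neg, Int.cast_one]
        have hP : 0 < x 0 ^ 3 + -1 := by have := cube_sub_one_pos hx1; linarith
        exact (div_pos (by norm_num) (Real.sqrt_pos.2 hP)).ne'
      · have hi : i = 0 := Subsingleton.elim i 0
        subst hi
        exact hx.2.le
    · filter_upwards [ae_restrict_mem hmeas] with x hx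
      show 0 ≤ integrand 0 (-1) 1 x
      exact div_nonneg (by norm_num) (Real.sqrt_nonneg _)
  linarith

/-- **Refuted strengthening**: the additivity sub-calculus does not connect the real-sector
representations of the ℚ-isomorphic models `y² = x³ − 1`, `y² = x³ − 64` (values `ϖ₃ = ϖ₃`, by one
change of variables). Rule 2) or 3) is NECESSARY in the sector. [folklore] -/
theorem not_RealPeriodSectorCompleteByAdditivity : ¬ RealPeriodSectorCompleteByAdditivity := by
  intro h
  exact of_fermatRep_sub_of_fermat64Rep_not_mem_closure_add
    (h 0 (-1) 0 (-64) (by norm_num) (by norm_num) 1 2 one_pos two_pos (fermatRep 1) (fermat64Rep 2)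
      (fermatRep_hyps 1).1 (fermatRep_hyps 1).2 (fermat64Rep_hyps 2).1 (fermat64Rep_hyps 2).2
      (by rw [value_fermatRep, value_fermat64Rep]; norm_num))


end Summit.KontsevichZagierPeriods.IsogenyCertificates.RealPeriodSectorCompleteNegative
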